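import Summits.QuantumFields.YangMills.Theorems.UnitScaleTiltProp7FrameRem2RecursionT3
import Summits.QuantumFields.YangMills.Theorems.UnitScaleTiltProp7FrameRem2Induction
import HarnessLib

/-!
# `UnitScaleTiltProp7FrameRem2TopT3` — REM2ˢ AT THE TOP OF THE TOWER, ABSTRACT-ℓ FORM (R0-RECURSION file F-γ3a): the T³ recursion ✓`Prop7FrameRem2RecursionT3.frameRem2_recursion_T3` (F-γ2) fed into
# the pure-real induction ✓`Prop7FrameRem2Induction.frameRem2_induction` (F-γ1):
# **`Σ_y ‖v_{K−n}(y) − 1 − ℓ_{K−n}(y)‖ ≤ 2L·(c_B·A_M + c_D·A_D + 91·A_Φ)·ℓ⁻¹ + (c_B·B_M + c_D·B_D + 91·B_Φ)·ℓ`**, `ℓ = L^{K−n}`, `c_B = 9L²∕2 + 171L²`, `c_D = 3L∕2`,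
# with the single-bar (`A_M, B_M`), frame (`A_Φ, B_Φ`) and «(n3)₂-sym» (`A_D, B_D`) level profiles DISPLAYED as two-slot rows
(route `UnitScaleTilt`, crux K1 «MinimiserStabilityRegPr» stmt-QuantumFields-19200; ★★OWNER RULINGS №19 (3)∕№20; LOCATE `LOCATE-R0-RECURSION-px13g6.md` §1–§3; def-free, count-neutral).
Cell `ym3-torus` (HUMAN RULING D-0037, YM ladder rung R3 — YM₃ on T³ is a rung, not d = 4, not infinite volume, not a mass gap, not Clay), width seat `ym3-torus-px13` (gen 6).

THE ROWS (all in ✓`frameRem2_recursion_T3`'s letters): its binders VERBATIM; `hℓ0 : ℓ 0 = 0` (the level-0 frames are `1`, their linear part vanishes); the three level profiles for `l ≤ K − n`: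
`hM` single-bar masses `Σ_b‖pertVar Ūˡ W̄ˡ b‖² ≤ A_M(Lˡ)⁻¹ + B_MLˡ` (✓px17 (n3) `sum_normSq_levelRatio_le_LOnly_T3`: `A_M = 7M₀`), `hΦ` frame masses `Σ_x‖v_l x − 1‖² ≤ A_Φ(Lˡ)⁻¹ + B_ΦLˡ` (✓px17 `frameMass_recursion_T3` ∘
✓`frameMass_induction`), `hDs` the «(n3)₂-sym» masses `Σ_b D l b ≤ A_D(Lˡ)⁻¹ + B_DLˡ` (OPEN; sym twin of `hMcomb₂`).  The identification `ℓ := fderiv` (★routeR-w2 ✓`fderiv_coe_frameAccU_succ_apply` ∘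
✓`fderiv_holT_ratio_apply`) that turns the conclusion into ✓`Prop7R0OfFrameRows`'s summed `hrs` row is F-γ3b.
WHAT IS PROVED (sorry-free): `sum_norm_frameAccU_zero_sub_one_sub_eq_zero` (`Ψ_0 = 0`) and ★★★ `frameRem2_top_T3` (the title).
HONEST FRAMING.  Bookkeeping; the analytic content of REM2ˢ is the displayed `hDs`; nothing of (β)∕hPA2∕hcoS∕E′∕EX∕the crux is proved; rung R3, not Clay; YM gap NOT proved.  `--supports stmt-QuantumFields-19200 --as helper`.
References: T. Bałaban, CMP 98 (1985) 17–51 [Balaban1985Averaging] ((97) p.32, Prop. 3 (122)–(126) p.36); CMP 109 (1987) 249–301 [Balaban1987RG1] ((0.3)–(0.4) pp.252–253).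
-/

set_option autoImplicit false

noncomputable section

open scoped BigOperators Matrix.Norms.L2Operator

namespace Summit.QuantumFields.YangMills.Theorems.Prop7FrameRem2TopT3

open Finset
open Literature.MathematicalPhysics.QuantumFieldTheory.Balaban1983to89
open Literature.MathematicalPhysics.QuantumFieldTheory.Balaban1983to89.T3ContinuumYM3Torus
open T4Continuum T4ReflectionCone BlockAveraging AveragingRT ExpMeanLog BlockAveragingEMLLinearisedBackground
open B10Eq27TorusAxialLog (holT transl unitsField toUField)
open B7Prop1Explicit (disp)
open Summit.QuantumFields.YangMills.Theorems.Prop8Chart (emlIterU)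
open Summit.QuantumFields.YangMills.Theorems.Prop7SymAvgTwSym (frameAccU frameAccU_zero)
open Summit.QuantumFields.YangMills.Theorems.Prop7FrameRem2RecursionT3 (frameRem2_recursion_T3)
open Summit.QuantumFields.YangMills.Theorems.Prop7FrameRem2Induction (frameRem2_induction)

section T3

variable (F : T3Family) (n K : ℕ)

/-- `Ψ_0 = 0`: at level `0` the accumulated frames are `1` (✓`frameAccU_zero`), so with the zero linear part every second-order remainder vanishes. [cite: Balaban1985Averaging, (97) p.32] -/
theorem sum_norm_frameAccU_zero_sub_one_sub_eq_zero (U₀ W : GaugeField (F.P K) 0 (Matrix.specialUnitaryGroup (Fin 2) ℂ))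
    (ℓ : (l : ℕ) → Site (F.P K) l → Matrix (Fin 2) (Fin 2) ℂ) (hℓ0 : ∀ x, ℓ 0 x = 0) :
    ∑ x : Site (F.P K) 0, ‖((frameAccU 0 (unitsField (toUField U₀)) (unitsField (toUField W)) x : (Matrix (Fin 2) (Fin 2) ℂ)ˣ) : Matrix (Fin 2) (Fin 2) ℂ) - 1 - ℓ 0 x‖ = 0 := by
  refine Finset.sum_eq_zero fun x _ => ?_
  rw [hℓ0, frameAccU_zero]
  simp

/-- ★★★ **REM2ˢ AT THE TOP, ABSTRACT-ℓ FORM**: under ✓`frameRem2_recursion_T3`'s binders, `ℓ 0 = 0`, and the displayed two-slot level profiles `hM` (single-bar), `hΦ` (frames), `hDs` («(n3)₂-sym»), all constants `≥ 0`: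
`Σ_y ‖v_{K−n}(y) − 1 − ℓ (K−n) y‖ ≤ 2L·((9L²∕2 + 171L²)·A_M + (3L∕2)·A_D + 91·A_Φ)·(L^{K−n})⁻¹ + ((9L²∕2 + 171L²)·B_M + (3L∕2)·B_D + 91·B_Φ)·L^{K−n}`.
[cite: Balaban1985Averaging, (97) p.32, Prop. 3 (122)-(126) p.36; Balaban1987RG1, (0.3)-(0.4) pp.252-253] -/
theorem frameRem2_top_T3 (U₀ W : GaugeField (F.P K) 0 (Matrix.specialUnitaryGroup (Fin 2) ℂ))
    (hU₀g : ∀ i, i < K - n → ∀ c : PBond (F.P K) (i + 1), Small (expMeanLogSU (n := Fin 2)) (Averaging.iter (fun j => blockAvg (P := F.P K) (j := j) (expMeanLogSU (n := Fin 2))) i U₀) c)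
    (hWg : ∀ i, i < K - n → ∀ c : PBond (F.P K) (i + 1), Small (expMeanLogSU (n := Fin 2)) (Averaging.iter (fun j => blockAvg (P := F.P K) (j := j) (expMeanLogSU (n := Fin 2))) i W) c)
    (μ : ℕ → ℝ)
    (hμ : ∀ j < K - n, ∀ c : PBond (F.P K) (j + 1), ((((F.P K).d + 2) * (F.P K).L : ℕ) : ℝ) * ∑ b ∈ (univ.filter (fun b : PBond (F.P K) j => blockOf b.src = c.src ∨ blockOf b.src = c.tgt)), ‖(pertVar (Averaging.iter (fun i => blockAvg (P := (F.P K)) (j := i) (expMeanLogSU (n := Fin 2))) j U₀) (Averaging.iter (fun i => blockAvg (P := (F.P K)) (j := i) (expMeanLogSU (n := Fin 2))) j W)) b‖ ≤ μ j)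
    (hμ72 : ∀ j < K - n, 72 * μ j ≤ 1)
    {θ : ℝ} (hθ0 : 0 ≤ θ) (hμθ : ∀ j < K - n, 7800 * (F.L : ℝ) ^ 3 * (F.L : ℝ) ^ (K - n) * μ j ≤ θ * (F.L : ℝ) ^ j)
    (hθL : 1000 * θ * (F.L : ℝ) ≤ 1)
    (ℓ : (l : ℕ) → Site (F.P K) l → Matrix (Fin 2) (Fin 2) ℂ) (ℓY : (l : ℕ) → PBond (F.P K) l → Matrix (Fin 2) (Fin 2) ℂ) (hℓ0 : ∀ x, ℓ 0 x = 0)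
    (hℓ : ∀ l, l < K - n → ∀ y : Site (F.P K) (l + 1), ℓ (l + 1) y
      = ((Fintype.card (Idx (F.P K)) : ℂ))⁻¹ • ∑ i : Idx (F.P K),
          (covWalkSum (Averaging.iter (fun j => blockAvg (P := (F.P K)) (j := j) (expMeanLogSU (n := Fin 2))) l U₀) (ℓY l) (walk (emb y) (stairWord i.2.1 (off i.1)))
            + ((holT (emlIterU l (unitsField (toUField U₀))) (emb y) (stairWord i.2.1 (off i.1)) : (Matrix (Fin 2) (Fin 2) ℂ)ˣ) : Matrix (Fin 2) (Fin 2) ℂ)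
              * ℓ l (transl (emb y) (disp (stairWord i.2.1 (off i.1))))
              * (((holT (emlIterU l (unitsField (toUField U₀))) (emb y) (stairWord i.2.1 (off i.1)))⁻¹ : (Matrix (Fin 2) (Fin 2) ℂ)ˣ) : Matrix (Fin 2) (Fin 2) ℂ)))
    (D : (l : ℕ) → PBond (F.P K) l → ℝ) (hD0 : ∀ l b, 0 ≤ D l b)
    (hD : ∀ l, l < K - n → ∀ b : PBond (F.P K) l,
      ‖pertVar (Averaging.iter (fun i => blockAvg (P := (F.P K)) (j := i) (expMeanLogSU (n := Fin 2))) l U₀) (Averaging.iter (fun i => blockAvg (P := (F.P K)) (j := i) (expMeanLogSU (n := Fin 2))) l W) b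
        - ℓY l b‖ ≤ D l b)
    {AM BM AD BD AΦ BΦ : ℝ} (hAM : 0 ≤ AM) (hBM : 0 ≤ BM) (hAD : 0 ≤ AD) (hBD : 0 ≤ BD) (hAΦ : 0 ≤ AΦ) (hBΦ : 0 ≤ BΦ)
    (hM : ∀ l ≤ K - n, ∑ b : PBond (F.P K) l, ‖(pertVar (Averaging.iter (fun i => blockAvg (P := (F.P K)) (j := i) (expMeanLogSU (n := Fin 2))) l U₀) (Averaging.iter (fun i => blockAvg (P := (F.P K)) (j := i) (expMeanLogSU (n := Fin 2))) l W)) b‖ ^ 2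
      ≤ AM * ((F.L : ℝ) ^ l)⁻¹ + BM * (F.L : ℝ) ^ l)
    (hDs : ∀ l ≤ K - n, ∑ b : PBond (F.P K) l, D l b ≤ AD * ((F.L : ℝ) ^ l)⁻¹ + BD * (F.L : ℝ) ^ l)
    (hΦ : ∀ l ≤ K - n, ∑ x : Site (F.P K) l, ‖((frameAccU l (unitsField (toUField U₀)) (unitsField (toUField W)) x : (Matrix (Fin 2) (Fin 2) ℂ)ˣ) : Matrix (Fin 2) (Fin 2) ℂ) - 1‖ ^ 2
      ≤ AΦ * ((F.L : ℝ) ^ l)⁻¹ + BΦ * (F.L : ℝ) ^ l) :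
    ∑ y : Site (F.P K) (K - n), ‖((frameAccU (K - n) (unitsField (toUField U₀)) (unitsField (toUField W)) y : (Matrix (Fin 2) (Fin 2) ℂ)ˣ) : Matrix (Fin 2) (Fin 2) ℂ) - 1 - ℓ (K - n) y‖
      ≤ 2 * (F.L : ℝ) * ((9 * (F.L : ℝ) ^ 2 / 2 + 171 * (F.L : ℝ) ^ 2) * AM + 3 * (F.L : ℝ) / 2 * AD + 91 * AΦ) * ((F.L : ℝ) ^ (K - n))⁻¹
        + ((9 * (F.L : ℝ) ^ 2 / 2 + 171 * (F.L : ℝ) ^ 2) * BM + 3 * (F.L : ℝ) / 2 * BD + 91 * BΦ) * (F.L : ℝ) ^ (K - n) := by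
  have hL3 : (3 : ℝ) ≤ F.L := Prop7CurvedLandauKnitT3.three_le_L F
  have hL2 : (2 : ℝ) ≤ F.L := by linarith
  have hrec := frameRem2_recursion_T3 F n K U₀ W hU₀g hWg μ hμ hμ72 hθ0 hμθ hθL ℓ ℓY hℓ D hD0 hD
  have h := frameRem2_induction (L := F.L) (cB := 9 * (F.L : ℝ) ^ 2 / 2 + 171 * (F.L : ℝ) ^ 2) (cD := 3 * (F.L : ℝ) / 2) (cΦ := 91) hL2
    (by positivity) (by positivity) (by norm_num) hAM hBM hAD hBD hAΦ hBΦ (K - n)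
    (fun l => ∑ x : Site (F.P K) l, ‖((frameAccU l (unitsField (toUField U₀)) (unitsField (toUField W)) x : (Matrix (Fin 2) (Fin 2) ℂ)ˣ) : Matrix (Fin 2) (Fin 2) ℂ) - 1 - ℓ l x‖)
    (fun l => ∑ b : PBond (F.P K) l, ‖(pertVar (Averaging.iter (fun i => blockAvg (P := (F.P K)) (j := i) (expMeanLogSU (n := Fin 2))) l U₀) (Averaging.iter (fun i => blockAvg (P := (F.P K)) (j := i) (expMeanLogSU (n := Fin 2))) l W)) b‖ ^ 2)
    (fun l => ∑ b : PBond (F.P K) l, D l b)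
    (fun l => ∑ x : Site (F.P K) l, ‖((frameAccU l (unitsField (toUField U₀)) (unitsField (toUField W)) x : (Matrix (Fin 2) (Fin 2) ℂ)ˣ) : Matrix (Fin 2) (Fin 2) ℂ) - 1‖ ^ 2)
    (sum_norm_frameAccU_zero_sub_one_sub_eq_zero F K U₀ W ℓ hℓ0) (fun l hl => by linarith [hrec l hl]) hM hDs hΦ
  exact h (K - n) le_rfl

end T3

end Summit.QuantumFields.YangMills.Theorems.Prop7FrameRem2TopT3

end
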